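import Mathlib
import HarnessLib

/-!
# Bourgain's mean value `A₆(N, δ, Δ)` for Huxley's first spacing problem (J. Amer. Math. Soc. 30
# (2017), Theorem 2 and Corollary 3): definitions and the proved reductions

Topic `Literature/NumberTheory/LFunctions`. Companion of `ZetaSubconvexity.lean` (the decomposition
of the named fact `Literature.NumberTheory.LFunctions.bourgain_subconvexity` = Bourgain's Theorem 5,
`|ζ(1/2 + it)| ≪ |t|^{13/84 + ε}`) and of `BourgainTheorem4.lean`. There the frontier of the
discharge is Bourgain's Theorem 4 (`Literature.NumberTheory.LFunctions.Bourgain2017_theorem4_log`),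
resting on the Bombieri–Iwaniec–Huxley–Watt method, into which the paper feeds ONE new input ("The
only input of this paper is to provide an optimal result for the first spacing problem (see
Corollary 3 below)", §1): the essentially sharp bound for Huxley's twelfth-moment mean value `A₆`,

* §1 (0.1) / §3 Theorem 2, eq. (2.12):
  `A₆(1/N², 1/N) = ∫₀¹∫₀¹∫₋₁¹∫₋₁¹ |∑_{1 ≤ n ≤ N} e(n x₁ + n² x₂ + N^{1/2} n^{3/2} x₃ + N^{1/2} n^{1/2} x₄)|¹² dx`
  `≪ N^{6 + ε}`;
* §3 Corollary 3, eq. (2.28) ("Using the notation from [H], Theorem 2 implies"): for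
  `1/N² ≤ δ ≤ 1`, `1/N ≤ Δ ≤ 1`,
  `A₆(N, δ, Δ) = ∫₀¹∫₀¹∫₋₁¹∫₋₁¹ |∑_{n ≤ N} e(n x₁ + n² x₂ + δ⁻¹ (n/N)^{3/2} x₃ + Δ⁻¹ (n/N)^{1/2} x₄)|¹² dx`
  `≪ δ Δ N^{9 + ε}`
  ("Considering the major arc contribution, (2.28) is clearly seen to be essentially best possible").

In the proof of Theorem 4 (§4, p. 11) Corollary 3 enters through (3.10): the first-spacing count
`A` of the Bombieri–Iwaniec double large sieve satisfies `A ≤ (π⁸/4) A₆(H; δ, Hδ)` ([H] Lemma 5.6.5)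
and `A₆(H; δ, Hδ) ≪ δ² H^{10 + ε}` for `1/H ≤ Hδ ≤ 1` — the latter is the proved specialisation
`Literature.NumberTheory.LFunctions.Bourgain2017_eq310_of_corollary3` below.

## Content

* `bourgainA6Phase N δ Δ x n`, `bourgainA6Sum N δ Δ x`, `bourgainA6Box`, `bourgainA6 N δ Δ` —
  DEFINITIONS: the phase, the sum `∑_{1 ≤ n ≤ N} e(…)`, the box `[0,1]² × [-1,1]²` and the mean value
  `A₆(N, δ, Δ)` of (2.28), with `e(z) = exp(2πiz)`; API: `norm_bourgainA6Sum_le` (`|∑| ≤ N`),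
  `bourgainA6_nonneg`, `bourgainA6_le` (trivial bound `A₆ ≤ 4 N¹²`), and `bourgainA6Phase_theorem2`
  (at `δ = 1/N²`, `Δ = 1/N` the phase is the printed phase of (2.12)).
* `Bourgain2017_theorem2_of_corollary3` — PROVED: Theorem 2 (2.12), `A₆(N, 1/N², 1/N) ≤ C(ε) N^{6+ε}`
  (`N ≥ 1`), is Corollary 3 (2.28) at `(δ, Δ) = (1/N², 1/N)`; the sibling
  `BourgainDecouplingMeanValueProofs.lean` proves the converse (`Bourgain2017_corollary3_of_theorem2`,
  the paper's "Theorem 2 implies Corollary 3" by the rescaling `x₃ = δ y₃`, `x₄ = Δ y₄`) and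
  `Bourgain2017_corollary3_iff_theorem2`, so the two printed statements are equivalent.
* `Bourgain2017_eq310_of_corollary3` — PROVED: the form used in (3.10), `A₆(H; δ, Hδ) ≤ C δ² H^{10+ε}`
  for `1/H² ≤ δ ≤ 1/H`, from Corollary 3.

## Why Theorem 2 / Corollary 3 are explicit hypotheses here and not a named fact (D-0026)

In all three reductions the printed Corollary 3 (2.28) (resp. Theorem 2 (2.12)) is written out as an
EXPLICIT hypothesis, `∀ ε > 0, ∃ C, ∀ N ≥ 1, ∀ δ ∈ [1/N², 1], ∀ Δ ∈ [1/N, 1], A₆(N, δ, Δ) ≤ C δ Δ N^{9+ε}`.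
Its content is the paper's decoupling theorem: Theorem 1 (`d = 4`, eqs. (2.1)/(2.10)), itself a
bootstrap (1.18)–(1.26) over the Bourgain–Demeter `L⁶` decoupling inequality (1.5) for planar curves
of non-vanishing curvature [B-D1], followed by two further 2D decouplings with periodicity
((2.4)–(2.10)), the Taylor reductions (2.13)–(2.23), and the multilinear-to-linear induction on
scales of [B-G] ((2.24)–(2.27)). None of this machinery (Fourier restriction / `ℓ²` decoupling,
wave-packet decompositions, multilinear Kakeya) exists in Mathlib or in this tree: the statement is
theory-sized, its natural intermediate results ([B-D1] Thm 1.1; Thm 1 of the paper, which as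
printed suppresses the weights `w_N` — "Strictly speaking, `L⁶_#(B_N)` … should be some weighted
space … this technical point will be ignored" — and so has no faithful verbatim formal statement)
are theory-sized as well, and no glue in the tree consumes it: the discharge path of
`Literature.NumberTheory.LFunctions.bourgain_subconvexity`
(`Literature.NumberTheory.LFunctions.bourgain_subconvexity_of_theorem4_of_sargos`,
`ZetaSubconvexityRobertSargos.lean`) goes through
`Literature.NumberTheory.LFunctions.Bourgain2017_theorem4_log`, inside whose printed proof (step 3,
(3.10), `BourgainTheorem4.lean`) the bound sits together with the rest of the
Bombieri–Iwaniec–Huxley–Watt machinery. It was therefore merged back into that obligation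
(review of the decomposition, 2026-08-15) instead of being carried as a separate named fact; a route
that needs (2.28) as a citable assumption re-vendors it from the docstrings below (same cite).

## Faithfulness notes (for the explicit hypotheses)

* "`n ≤ N`" is `1 ≤ n ≤ N` ((0.1) prints `∑_{1 ≤ n ≤ N}`), rendered `Finset.Icc 1 N` with `N : ℕ`.
* "`≪ N^{6+ε}`", "`≪ δΔN^{9+ε}`": for every `ε > 0` an implied constant depending on `ε` only,
  uniform in `N ≥ 1` and in `δ, Δ` in the printed ranges: `∀ ε > 0, ∃ C, ∀ N ≥ 1, …`.
* The four-fold integral `∫₀¹∫₀¹∫₋₁¹∫₋₁¹ … dx₁dx₂dx₃dx₄` of the continuous bounded integrand is written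
  as the Lebesgue integral over the box `Set.Icc ![0,0,-1,-1] ![1,1,1,1] ⊂ (Fin 4 → ℝ)` for the
  product measure `volume` (a genuine integral: `integrableOn_bourgainA6_integrand` in the sibling
  proof file).

## References

* J. Bourgain, *Decoupling, exponential sums and the Riemann zeta function*, J. Amer. Math. Soc.
  30 (2017), 205–224, doi:10.1090/jams/860, arXiv:1408.5794 — §1 (0.1), Theorem 2 (2.12),
  Corollary 3 (2.28), §4 (3.10).
* M. N. Huxley, *Area, Lattice Points, and Exponential Sums*, LMS Monographs 13, Oxford 1996 ([H]
  of the paper: the notation `A_r`, Lemma 5.6.5).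
-/

noncomputable section

open Complex MeasureTheory Finset
open scoped Real

namespace Literature.NumberTheory.LFunctions

/-! ## The mean value `A₆(N, δ, Δ)` -/

/-- The phase of the sum in Bourgain's (2.28): for `x = (x₁, x₂, x₃, x₄)` and `1 ≤ n ≤ N`,
`n x₁ + n² x₂ + δ⁻¹ (n/N)^{3/2} x₃ + Δ⁻¹ (n/N)^{1/2} x₄`.
[cite: BourgainJAMS2017, Corollary 3, eq. (2.28)] -/
def bourgainA6Phase (N : ℕ) (δ Δ : ℝ) (x : Fin 4 → ℝ) (n : ℕ) : ℝ :=
  n * x 0 + (n : ℝ) ^ 2 * x 1 + δ⁻¹ * ((n : ℝ) / N) ^ (3 / 2 : ℝ) * x 2 +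
    Δ⁻¹ * ((n : ℝ) / N) ^ (1 / 2 : ℝ) * x 3

/-- The exponential sum of Bourgain's (2.28),
`∑_{1 ≤ n ≤ N} e(n x₁ + n² x₂ + δ⁻¹ (n/N)^{3/2} x₃ + Δ⁻¹ (n/N)^{1/2} x₄)`, `e(z) = exp(2πiz)`.
[cite: BourgainJAMS2017, Corollary 3, eq. (2.28)] -/
def bourgainA6Sum (N : ℕ) (δ Δ : ℝ) (x : Fin 4 → ℝ) : ℂ :=
  ∑ n ∈ Finset.Icc 1 N, Complex.exp (2 * ↑π * I * ↑(bourgainA6Phase N δ Δ x n))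

/-- The box of integration `[0, 1] × [0, 1] × [-1, 1] × [-1, 1] ⊂ ℝ⁴` of (0.1), (2.12), (2.28).
[cite: BourgainJAMS2017, Corollary 3, eq. (2.28)] -/
def bourgainA6Box : Set (Fin 4 → ℝ) :=
  Set.Icc ![0, 0, -1, -1] ![1, 1, 1, 1]

/-- Huxley's twelfth-moment mean value in Bourgain's normalisation (2.28):
`A₆(N, δ, Δ) = ∫₀¹∫₀¹∫₋₁¹∫₋₁¹ |∑_{n ≤ N} e(n x₁ + n² x₂ + δ⁻¹ (n/N)^{3/2} x₃ + Δ⁻¹ (n/N)^{1/2} x₄)|¹² dx`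
(Lebesgue integral over the box for the product measure).
[cite: BourgainJAMS2017, Corollary 3, eq. (2.28)] -/
def bourgainA6 (N : ℕ) (δ Δ : ℝ) : ℝ :=
  ∫ x in bourgainA6Box, ‖bourgainA6Sum N δ Δ x‖ ^ 12

/-- Unfolding lemma for `bourgainA6`. [folklore] -/
theorem bourgainA6_def (N : ℕ) (δ Δ : ℝ) :
    bourgainA6 N δ Δ = ∫ x in bourgainA6Box, ‖bourgainA6Sum N δ Δ x‖ ^ 12 :=
  rfl

/-- The trivial bound `|∑_{1 ≤ n ≤ N} e(…)| ≤ N` (each term is unimodular). [folklore] -/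
theorem norm_bourgainA6Sum_le (N : ℕ) (δ Δ : ℝ) (x : Fin 4 → ℝ) :
    ‖bourgainA6Sum N δ Δ x‖ ≤ N := by
  unfold bourgainA6Sum
  refine (norm_sum_le _ _).trans ?_
  have h : ∀ n ∈ Finset.Icc 1 N,
      ‖Complex.exp (2 * ↑π * I * ↑(bourgainA6Phase N δ Δ x n))‖ = 1 := by
    intro n _
    rw [show (2 * ↑π * I * ↑(bourgainA6Phase N δ Δ x n) : ℂ) =
        ↑(2 * π * bourgainA6Phase N δ Δ x n) * I by push_cast; ring]
    exact Complex.norm_exp_ofReal_mul_I _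
  rw [Finset.sum_congr rfl h]
  simp

/-- The box `[0,1]² × [-1,1]²` has Lebesgue measure `4`. [folklore] -/
theorem volume_bourgainA6Box : (volume bourgainA6Box).toReal = 4 := by
  unfold bourgainA6Box
  rw [Real.volume_Icc_pi_toReal]
  · simp [Fin.prod_univ_four]
    norm_num
  · intro i
    fin_cases i <;> simp

/-- The box `[0,1]² × [-1,1]²` has Lebesgue measure `4` (`Measure.real` form). [folklore] -/
theorem volume_real_bourgainA6Box : (volume : Measure (Fin 4 → ℝ)).real bourgainA6Box = 4 := by
  rw [measureReal_def]
  exact volume_bourgainA6Box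

/-- `A₆(N, δ, Δ) ≥ 0`. [folklore] -/
theorem bourgainA6_nonneg (N : ℕ) (δ Δ : ℝ) : 0 ≤ bourgainA6 N δ Δ := by
  unfold bourgainA6
  exact setIntegral_nonneg measurableSet_Icc fun x _ => by positivity

/-- The trivial bound `A₆(N, δ, Δ) ≤ 4 N¹²` (integrand `≤ N¹²` on a box of measure `4`). [folklore] -/
theorem bourgainA6_le (N : ℕ) (δ Δ : ℝ) : bourgainA6 N δ Δ ≤ 4 * (N : ℝ) ^ 12 := by
  unfold bourgainA6
  have hvol : volume bourgainA6Box < ⊤ := by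
    unfold bourgainA6Box
    exact measure_Icc_lt_top
  have hb : ∀ x ∈ bourgainA6Box, ‖‖bourgainA6Sum N δ Δ x‖ ^ 12‖ ≤ (N : ℝ) ^ 12 := by
    intro x _
    rw [Real.norm_of_nonneg (by positivity)]
    exact pow_le_pow_left₀ (norm_nonneg _) (norm_bourgainA6Sum_le N δ Δ x) 12
  have h := norm_setIntegral_le_of_norm_le_const hvol hb
  rw [volume_real_bourgainA6Box] at h
  have h' : ∫ x in bourgainA6Box, ‖bourgainA6Sum N δ Δ x‖ ^ 12 ≤
      ‖∫ x in bourgainA6Box, ‖bourgainA6Sum N δ Δ x‖ ^ 12‖ := Real.le_norm_self _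
  linarith

/-- At `δ = 1/N²`, `Δ = 1/N` (`N ≥ 1`) the phase of (2.28) is the printed phase of (0.1)/(2.12):
`n x₁ + n² x₂ + N^{1/2} n^{3/2} x₃ + N^{1/2} n^{1/2} x₄`. [cite: BourgainJAMS2017, §1 eq. (0.1)] -/
theorem bourgainA6Phase_theorem2 {N : ℕ} (hN : 1 ≤ N) (x : Fin 4 → ℝ) (n : ℕ) :
    bourgainA6Phase N (1 / (N : ℝ) ^ 2) (1 / N) x n =
      n * x 0 + (n : ℝ) ^ 2 * x 1 + (N : ℝ) ^ (1 / 2 : ℝ) * (n : ℝ) ^ (3 / 2 : ℝ) * x 2 +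
        (N : ℝ) ^ (1 / 2 : ℝ) * (n : ℝ) ^ (1 / 2 : ℝ) * x 3 := by
  unfold bourgainA6Phase
  have hNpos : (0 : ℝ) < N := by exact_mod_cast hN
  have hn : (0 : ℝ) ≤ n := Nat.cast_nonneg n
  have h1 : (1 / (N : ℝ) ^ 2)⁻¹ * ((n : ℝ) / N) ^ (3 / 2 : ℝ) =
      (N : ℝ) ^ (1 / 2 : ℝ) * (n : ℝ) ^ (3 / 2 : ℝ) := by
    have hne : (N : ℝ) ^ (3 / 2 : ℝ) ≠ 0 := (Real.rpow_pos_of_pos hNpos _).ne'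
    have hs : (N : ℝ) ^ (1 / 2 : ℝ) * (N : ℝ) ^ (3 / 2 : ℝ) = (N : ℝ) ^ 2 := by
      rw [← Real.rpow_add hNpos, ← Real.rpow_two]; norm_num
    rw [Real.div_rpow hn hNpos.le, one_div, inv_inv]
    calc (N : ℝ) ^ 2 * ((n : ℝ) ^ (3 / 2 : ℝ) / (N : ℝ) ^ (3 / 2 : ℝ))
        = (N : ℝ) ^ 2 / (N : ℝ) ^ (3 / 2 : ℝ) * (n : ℝ) ^ (3 / 2 : ℝ) := by ring
      _ = (N : ℝ) ^ (1 / 2 : ℝ) * (n : ℝ) ^ (3 / 2 : ℝ) := by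
          have hq : (N : ℝ) ^ 2 / (N : ℝ) ^ (3 / 2 : ℝ) = (N : ℝ) ^ (1 / 2 : ℝ) := by
            rw [div_eq_iff hne]; exact hs.symm
          rw [hq]
  have h2 : (1 / (N : ℝ))⁻¹ * ((n : ℝ) / N) ^ (1 / 2 : ℝ) =
      (N : ℝ) ^ (1 / 2 : ℝ) * (n : ℝ) ^ (1 / 2 : ℝ) := by
    have hne : (N : ℝ) ^ (1 / 2 : ℝ) ≠ 0 := (Real.rpow_pos_of_pos hNpos _).ne'
    have hs : (N : ℝ) ^ (1 / 2 : ℝ) * (N : ℝ) ^ (1 / 2 : ℝ) = N := by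
      rw [← Real.rpow_add hNpos]; norm_num
    rw [Real.div_rpow hn hNpos.le, one_div, inv_inv]
    calc (N : ℝ) * ((n : ℝ) ^ (1 / 2 : ℝ) / (N : ℝ) ^ (1 / 2 : ℝ))
        = (N : ℝ) / (N : ℝ) ^ (1 / 2 : ℝ) * (n : ℝ) ^ (1 / 2 : ℝ) := by ring
      _ = (N : ℝ) ^ (1 / 2 : ℝ) * (n : ℝ) ^ (1 / 2 : ℝ) := by
          have hq : (N : ℝ) / (N : ℝ) ^ (1 / 2 : ℝ) = (N : ℝ) ^ (1 / 2 : ℝ) := by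
            rw [div_eq_iff hne]; exact hs.symm
          rw [hq]
  rw [h1, h2]

/-! ## The printed statements (2.12), (2.28) and the proved reductions

Bourgain's Corollary 3, eq. (2.28) ("Using the notation from [H], Theorem 2 implies"): "Let
`1/N² ≤ δ ≤ 1`, `1/N ≤ Δ ≤ 1`. Then
`A₆(N, δ, Δ) = ∫₀¹∫₀¹∫₋₁¹∫₋₁¹ |∑_{n ≤ N} e(n x₁ + n² x₂ + (1/δ)(n/N)^{3/2} x₃ + (1/Δ)(n/N)^{1/2} x₄)|¹² dx`
`≪ δ Δ N^{9+ε}`." In Lean (the explicit hypothesis `h` of the reductions below): for every `ε > 0`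
there is `C` (depending on `ε` only) with `A₆(N, δ, Δ) ≤ C δ Δ N^{9+ε}` for all `N ≥ 1` and all
`δ, Δ` in the printed ranges,
`∀ ε : ℝ, 0 < ε → ∃ C : ℝ, ∀ N : ℕ, 1 ≤ N → ∀ δ Δ : ℝ, 1 / N ^ 2 ≤ δ → δ ≤ 1 → 1 / N ≤ Δ → Δ ≤ 1 →`
`bourgainA6 N δ Δ ≤ C * δ * Δ * N ^ (9 + ε)`.
Theorem 2, eq. (2.12): "`∫₀¹∫₀¹∫₋₁¹∫₋₁¹ |∑_{n ≤ N} e(n x₁ + n² x₂ + N^{1/2} n^{3/2} x₃ + N^{1/2} n^{1/2} x₄)|¹²`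
`dx₁dx₂dx₃dx₄ ≪ N^{6+ε}`", i.e. `∀ ε > 0, ∃ C, ∀ N ≥ 1, bourgainA6 N (1/N²) (1/N) ≤ C N^{6+ε}` (the
phase identification is `bourgainA6Phase_theorem2`; (0.1) names this quantity `A₆(1/N², 1/N)`).
-/

/-- **Bourgain 2017, Theorem 2, eq. (2.12), from Corollary 3, eq. (2.28)** (= the bound
`A₆ ≪ N^{6+ε}` for the mean value (0.1) announced in §1): if, for every `ε > 0`,
`A₆(N, δ, Δ) ≤ C(ε) δ Δ N^{9+ε}` for all `N ≥ 1`, `1/N² ≤ δ ≤ 1`, `1/N ≤ Δ ≤ 1` (the printed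
Corollary 3, hypothesis `h`, written out explicitly), then for every `ε > 0`,
`A₆(N, 1/N², 1/N) ≤ C(ε) N^{6+ε}` for all `N ≥ 1` (the printed Theorem 2): Corollary 3 at
`(δ, Δ) = (1/N², 1/N)`, `δ Δ N^{9+ε} = N^{6+ε}`. The converse (the paper's "Theorem 2 implies
Corollary 3", by rescaling) is `Bourgain2017_corollary3_of_theorem2` in the sibling proof file.
[cite: BourgainJAMS2017, Theorem 2, eq. (2.12); Corollary 3, eq. (2.28)] -/
theorem Bourgain2017_theorem2_of_corollary3
    (h : ∀ ε : ℝ, 0 < ε → ∃ C : ℝ, ∀ N : ℕ, 1 ≤ N → ∀ δ Δ : ℝ,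
      1 / (N : ℝ) ^ 2 ≤ δ → δ ≤ 1 → 1 / (N : ℝ) ≤ Δ → Δ ≤ 1 →
        bourgainA6 N δ Δ ≤ C * δ * Δ * (N : ℝ) ^ (9 + ε)) :
    ∀ ε : ℝ, 0 < ε → ∃ C : ℝ, ∀ N : ℕ, 1 ≤ N →
      bourgainA6 N (1 / (N : ℝ) ^ 2) (1 / N) ≤ C * (N : ℝ) ^ (6 + ε) := by
  intro ε hε
  obtain ⟨C, hC⟩ := h ε hε
  refine ⟨C, fun N hN => ?_⟩
  have hNpos : (0 : ℝ) < N := by exact_mod_cast hN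
  have hN1 : (1 : ℝ) ≤ N := by exact_mod_cast hN
  have hδ1 : 1 / (N : ℝ) ^ 2 ≤ 1 := by
    rw [div_le_one (by positivity)]; nlinarith
  have hΔ1 : 1 / (N : ℝ) ≤ 1 := by
    rw [div_le_one hNpos]; exact hN1
  have key := hC N hN (1 / (N : ℝ) ^ 2) (1 / N) le_rfl hδ1 le_rfl hΔ1
  have hpow : C * (1 / (N : ℝ) ^ 2) * (1 / N) * (N : ℝ) ^ (9 + ε) = C * (N : ℝ) ^ (6 + ε) := by
    have e : (N : ℝ) ^ (9 + ε) = (N : ℝ) ^ ((3 : ℕ) : ℝ) * (N : ℝ) ^ (6 + ε) := by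
      rw [← Real.rpow_add hNpos]; congr 1; push_cast; ring
    rw [e, Real.rpow_natCast]
    field_simp
  rw [hpow] at key
  exact key

/-- **The form used in (3.10)** of the paper, from Corollary 3 (2.28) (hypothesis `h`, written
out explicitly): for `1/H² ≤ δ ≤ 1/H` (i.e. `1/H ≤ Hδ ≤ 1`), `A₆(H; δ, Hδ) ≤ C δ² H^{10+ε}`
("Therefore it follows by Corollary 3 that we have `A ≪ δ² H^{10+ε}` (3.10)").
[cite: BourgainJAMS2017, §4 eq. (3.10); Corollary 3, eq. (2.28)] -/
theorem Bourgain2017_eq310_of_corollary3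
    (h : ∀ ε : ℝ, 0 < ε → ∃ C : ℝ, ∀ N : ℕ, 1 ≤ N → ∀ δ Δ : ℝ,
      1 / (N : ℝ) ^ 2 ≤ δ → δ ≤ 1 → 1 / (N : ℝ) ≤ Δ → Δ ≤ 1 →
        bourgainA6 N δ Δ ≤ C * δ * Δ * (N : ℝ) ^ (9 + ε))
    {ε : ℝ} (hε : 0 < ε) :
    ∃ C : ℝ, ∀ H : ℕ, 1 ≤ H → ∀ δ : ℝ, 1 / (H : ℝ) ^ 2 ≤ δ → δ ≤ 1 / H →
      bourgainA6 H δ (H * δ) ≤ C * δ ^ 2 * (H : ℝ) ^ (10 + ε) := by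
  obtain ⟨C, hC⟩ := h ε hε
  refine ⟨C, fun H hH δ hδl hδu => ?_⟩
  have hHpos : (0 : ℝ) < H := by exact_mod_cast hH
  have hH1 : (1 : ℝ) ≤ H := by exact_mod_cast hH
  have hδ1 : δ ≤ 1 := hδu.trans (by rw [div_le_one hHpos]; exact hH1)
  have hΔl : 1 / (H : ℝ) ≤ H * δ := by
    have : 1 / (H : ℝ) = H * (1 / (H : ℝ) ^ 2) := by field_simp
    rw [this]
    exact mul_le_mul_of_nonneg_left hδl hHpos.le
  have hΔu : (H : ℝ) * δ ≤ 1 := by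
    calc (H : ℝ) * δ ≤ H * (1 / H) := mul_le_mul_of_nonneg_left hδu hHpos.le
      _ = 1 := by field_simp
  have key := hC H hH δ (H * δ) hδl hδ1 hΔl hΔu
  have e : C * δ * (H * δ) * (H : ℝ) ^ (9 + ε) = C * δ ^ 2 * (H : ℝ) ^ (10 + ε) := by
    have e' : (H : ℝ) ^ (10 + ε) = (H : ℝ) ^ (1 : ℝ) * (H : ℝ) ^ (9 + ε) := by
      rw [← Real.rpow_add hHpos]; congr 1; ring
    rw [e', Real.rpow_one]
    ring
  rw [e] at key
  exact key

end Literature.NumberTheory.LFunctions
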